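import Literature.Probability.LatticeModels.IsingFieldModel
import HarnessLib

/-!
# The Ising model with a site-dependent field: consistency in the volume, monotonicity in the
# volume, and the boundary-condition insensitivity of the free energy

Topic `Probability/LatticeModels`; continues `IsingFieldModel` (finite-volume Ising model with a
site-dependent field `h : V → ℝ`, Friedli–Velenik 2017, eq. (3.51) with `J ≡ 1`). Proved here:

* **Consistency / DLR in two steps** (Friedli–Velenik 2017, Lemma 6.7, eqs. (6.5), (6.10);
  Exercise 3.11): for `Λ' ⊆ Λ` the Boltzmann weight `w^η_Λ(τ)` is the weight `w^{η[τ₂]}_{Λ'}(τ₁)`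
  of the restriction `τ₁` of `τ` to `Λ'`, with the boundary condition updated by the restriction
  `τ₂` to `Λ ∖ Λ'`, times a factor not involving the spins of `Λ'`
  (`fieldWeight_fixed_eq_mul`, `sum_fieldWeight_fixed_eq_sum_sum`); hence the **spatial Markov
  property** `⟨F⟩^η_{Λ'} = ⟨F · 1[σ = η on Λ ∖ Λ']⟩^η_Λ / ⟨1[σ = η on Λ ∖ Λ']⟩^η_Λ`
  (`fieldExpect_fixed_eq_cond`, Friedli–Velenik eq. (3.26)).
* **Monotonicity in the volume** (Friedli–Velenik 2017, Lemma 3.22 / eq. (3.25), from FKG): if the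
  boundary condition is `+1` on `Λ ∖ Λ'`, shrinking the volume from `Λ` to `Λ'` (freezing those
  spins to `+1`) increases the expectation of every nondecreasing observable
  (`fieldExpect_fixed_anti_volume`); if it is `-1` there, it decreases it
  (`fieldExpect_fixed_mono_volume`). Valid for `β ≥ 0` and ANY field `h : V → ℝ`.
* **The free energy does not see the boundary condition up to surface terms**
  (Friedli–Velenik 2017, proof of Theorem 3.6 / Lemma 3.8: `|ℋ^{η}_Λ - ℋ^{η'}_Λ| ≤ 2|∂ᵉΛ|`): for
  `β ≥ 0`, `|log Z^{η₂}_{Λ;β,h} - log Z^{η₁}_{Λ;β,h}| ≤ 2β |∂ᵉΛ|` (`abs_log_fieldZ_fixed_sub_le`).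

## References

* S. Friedli, Y. Velenik, *Statistical Mechanics of Lattice Systems* (CUP 2017), §3.2.1 (proof
  of Thm. 3.6), §3.6.3 eqs. (3.25)–(3.26), Lemma 3.22, Exercise 3.11, Lemma 6.7.
-/

noncomputable section

open MeasureTheory Finset

namespace Literature.Probability.LatticeModels

variable {V : Type*} (G : SimpleGraph V) [DecidableEq V] [G.LocallyFinite]

/-! ### Consistency: the Boltzmann weight in two steps -/

/-- **The Boltzmann weight in two steps** (Friedli–Velenik 2017, proof of Lemma 6.7, eq. (6.10),
for the Hamiltonian (3.51)): for `Λ' ⊆ Λ`,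
`w^η_{Λ;β,h}(τ) = exp(β(∑_{e ∈ ℰ^b_Λ ∖ ℰ^b_{Λ'}} σ_e(η[τ₂]) + ∑_{x ∈ Λ∖Λ'} h_x η[τ₂]_x)) · w^{η[τ₂]}_{Λ';β,h}(τ₁)`
where `τ₁, τ₂` are the restrictions of `τ` and `η[τ₂]` is `η` updated by `τ₂` on `Λ ∖ Λ'`.
[cite: FriedliVelenik2017, Lemma 6.7, eq. (6.10)] -/
theorem fieldWeight_fixed_eq_mul {Λ' Λ : Finset V} (hsub : Λ' ⊆ Λ) (η : SpinConfig V)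
    (β : ℝ) (h : V → ℝ) (τ : Λ → ℤˣ) :
    fieldWeight G Λ β h (.fixed η) τ =
      Real.exp (β * (∑ e ∈ edgesTouching G Λ \ edgesTouching G Λ',
          bondSpin (glue (Λ \ Λ') (fun x => τ ⟨x, (Finset.mem_sdiff.1 x.2).1⟩) (.fixed η)) e +
        ∑ x ∈ Λ \ Λ',
          h x * spinAt x (glue (Λ \ Λ') (fun x => τ ⟨x, (Finset.mem_sdiff.1 x.2).1⟩) (.fixed η)))) *
      fieldWeight G Λ' β h
        (.fixed (glue (Λ \ Λ') (fun x => τ ⟨x, (Finset.mem_sdiff.1 x.2).1⟩) (.fixed η)))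
        (fun x => τ ⟨x, hsub x.2⟩) := by
  set η₂ := glue (Λ \ Λ') (fun x => τ ⟨x, (Finset.mem_sdiff.1 x.2).1⟩) (.fixed η) with hη₂
  set τ₁ : Λ' → ℤˣ := fun x => τ ⟨x, hsub x.2⟩ with hτ₁
  have hcfg : glue Λ τ (.fixed η) = glue Λ' τ₁ (.fixed η₂) := glue_fixed_eq_glue_glue hsub η τ
  rw [fieldWeight, fieldWeight, ← Real.exp_add, hcfg]
  congr 1
  set σ := glue Λ' τ₁ (.fixed η₂) with hσ
  have hout : ∀ x, x ∉ Λ' → σ x = η₂ x := fun x hx => by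
    rw [hσ, glue_apply_of_notMem _ _ _ hx, BoundaryCondition.outside_fixed]
  have hbond : ∀ e ∈ edgesTouching G Λ \ edgesTouching G Λ', bondSpin σ e = bondSpin η₂ e := by
    intro e he
    obtain ⟨heΛ, heΛ'⟩ := Finset.mem_sdiff.1 he
    have hends : ∀ z ∈ e, z ∉ Λ' := fun z hz hzΛ' =>
      heΛ' (mem_edgesTouching_iff.2 ⟨(mem_edgesTouching_iff.1 heΛ).1, z, hzΛ', hz⟩)
    induction e using Sym2.ind with
    | _ a b =>
      simp only [bondSpin_mk, spinAt, hout a (hends a (Sym2.mem_mk_left _ _)),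
        hout b (hends b (Sym2.mem_mk_right _ _))]
  have hfield : ∀ x ∈ Λ \ Λ', h x * spinAt x σ = h x * spinAt x η₂ := fun x hx => by
    simp only [spinAt, hout x (Finset.mem_sdiff.1 hx).2]
  have hE : ∑ e ∈ edgesTouching G Λ, bondSpin σ e =
      ∑ e ∈ edgesTouching G Λ', bondSpin σ e +
        ∑ e ∈ edgesTouching G Λ \ edgesTouching G Λ', bondSpin η₂ e := by
    rw [← Finset.sum_sdiff (edgesTouching_mono G hsub), add_comm, Finset.sum_congr rfl hbond]
  have hF : ∑ x ∈ Λ, h x * spinAt x σ =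
      ∑ x ∈ Λ', h x * spinAt x σ + ∑ x ∈ Λ \ Λ', h x * spinAt x η₂ := by
    rw [← Finset.sum_sdiff hsub, add_comm, Finset.sum_congr rfl hfield]
  simp only [fieldHamiltonian, interactionEdges_fixed, hE, hF]
  ring

/-- **Consistency (DLR) at the level of Boltzmann sums** (Friedli–Velenik 2017, Lemma 6.7,
eq. (6.5); the spatial Markov property of Exercise 3.11), for the Hamiltonian (3.51): for
`Λ' ⊆ Λ`, a fixed boundary condition `η` and any `F`, `∑_τ w^η_Λ(τ) F(τ ∨ η)` is obtained by
summing first over the spins `τ₂` of `Λ ∖ Λ'` (which update the boundary condition to `η[τ₂]`)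
and then over the spins `τ₁` of `Λ'`. [cite: FriedliVelenik2017, Lemma 6.7, eq. (6.5)] -/
theorem sum_fieldWeight_fixed_eq_sum_sum {Λ' Λ : Finset V} (hsub : Λ' ⊆ Λ) (η : SpinConfig V)
    (β : ℝ) (h : V → ℝ) (F : SpinConfig V → ℝ) :
    ∑ τ : Λ → ℤˣ, fieldWeight G Λ β h (.fixed η) τ * F (glue Λ τ (.fixed η)) =
      ∑ τ₂ : ↥(Λ \ Λ') → ℤˣ,
        Real.exp (β * (∑ e ∈ edgesTouching G Λ \ edgesTouching G Λ',
            bondSpin (glue (Λ \ Λ') τ₂ (.fixed η)) e +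
          ∑ x ∈ Λ \ Λ', h x * spinAt x (glue (Λ \ Λ') τ₂ (.fixed η)))) *
        ∑ τ₁ : Λ' → ℤˣ, fieldWeight G Λ' β h (.fixed (glue (Λ \ Λ') τ₂ (.fixed η))) τ₁ *
          F (glue Λ' τ₁ (.fixed (glue (Λ \ Λ') τ₂ (.fixed η)))) := by
  classical
  let r₁ : (Λ → ℤˣ) → (Λ' → ℤˣ) := fun τ x => τ ⟨x, hsub x.2⟩
  let r₂ : (Λ → ℤˣ) → (↥(Λ \ Λ') → ℤˣ) := fun τ x => τ ⟨x, (Finset.mem_sdiff.1 x.2).1⟩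
  let eqv : (Λ → ℤˣ) ≃ (Λ' → ℤˣ) × (↥(Λ \ Λ') → ℤˣ) :=
    { toFun := fun τ => (r₁ τ, r₂ τ)
      invFun := fun p x => if hx : (x : V) ∈ Λ' then p.1 ⟨x, hx⟩
        else p.2 ⟨x, Finset.mem_sdiff.2 ⟨x.2, hx⟩⟩
      left_inv := fun τ => by
        funext x
        by_cases hx : (x : V) ∈ Λ' <;> simp [r₁, r₂, hx]
      right_inv := fun p => by
        ext x
        · simp [r₁, x.2]
        · have hx : (x : V) ∉ Λ' := (Finset.mem_sdiff.1 x.2).2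
          simp [r₂, hx] }
  rw [← Equiv.sum_comp eqv.symm, Fintype.sum_prod_type_right]
  refine Finset.sum_congr rfl fun τ₂ _ => ?_
  rw [Finset.mul_sum]
  refine Finset.sum_congr rfl fun τ₁ _ => ?_
  have h1 : r₁ (eqv.symm (τ₁, τ₂)) = τ₁ := congrArg Prod.fst (eqv.apply_symm_apply (τ₁, τ₂))
  have h2 : r₂ (eqv.symm (τ₁, τ₂)) = τ₂ := congrArg Prod.snd (eqv.apply_symm_apply (τ₁, τ₂))
  have hw := fieldWeight_fixed_eq_mul G hsub η β h (eqv.symm (τ₁, τ₂))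
  have hc := glue_fixed_eq_glue_glue hsub η (eqv.symm (τ₁, τ₂))
  change fieldWeight G Λ β h (.fixed η) (eqv.symm (τ₁, τ₂)) =
    Real.exp (β * (∑ e ∈ edgesTouching G Λ \ edgesTouching G Λ',
        bondSpin (glue (Λ \ Λ') (r₂ (eqv.symm (τ₁, τ₂))) (.fixed η)) e +
      ∑ x ∈ Λ \ Λ', h x * spinAt x (glue (Λ \ Λ') (r₂ (eqv.symm (τ₁, τ₂))) (.fixed η)))) *
    fieldWeight G Λ' β h (.fixed (glue (Λ \ Λ') (r₂ (eqv.symm (τ₁, τ₂))) (.fixed η)))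
      (r₁ (eqv.symm (τ₁, τ₂))) at hw
  change glue Λ (eqv.symm (τ₁, τ₂)) (.fixed η) =
    glue Λ' (r₁ (eqv.symm (τ₁, τ₂))) (.fixed (glue (Λ \ Λ') (r₂ (eqv.symm (τ₁, τ₂))) (.fixed η))) at hc
  rw [h1, h2] at hw hc
  rw [hw, hc]
  ring

/-- **The partition function in two steps**: `Z^η_Λ = ∑_{τ₂} e^{β(…)} Z^{η[τ₂]}_{Λ'}` for
`Λ' ⊆ Λ`. [cite: FriedliVelenik2017, Lemma 6.7, eq. (6.5)] -/
theorem fieldZ_fixed_eq_sum {Λ' Λ : Finset V} (hsub : Λ' ⊆ Λ) (η : SpinConfig V) (β : ℝ)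
    (h : V → ℝ) :
    fieldZ G Λ β h (.fixed η) =
      ∑ τ₂ : ↥(Λ \ Λ') → ℤˣ,
        Real.exp (β * (∑ e ∈ edgesTouching G Λ \ edgesTouching G Λ',
            bondSpin (glue (Λ \ Λ') τ₂ (.fixed η)) e +
          ∑ x ∈ Λ \ Λ', h x * spinAt x (glue (Λ \ Λ') τ₂ (.fixed η)))) *
        fieldZ G Λ' β h (.fixed (glue (Λ \ Λ') τ₂ (.fixed η))) := by
  have := sum_fieldWeight_fixed_eq_sum_sum G hsub η β h (fun _ => 1)
  simp only [mul_one] at this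
  simpa only [fieldZ] using this

/-! ### The spatial Markov property: conditioning on the spins of `Λ ∖ Λ'` -/

/-- The event "the configuration agrees with `η` on `D`" as an indicator-valued observable.
[cite: FriedliVelenik2017, §3.6.3 eq. (3.26)] -/
def agreeIndicator (D : Finset V) (η : SpinConfig V) (σ : SpinConfig V) : ℝ :=
  open Classical in if ∀ x ∈ D, σ x = η x then 1 else 0

omit [DecidableEq V] [G.LocallyFinite] in
/-- `agreeIndicator` is measurable. [cite: FriedliVelenik2017, §6.2] -/
theorem measurable_agreeIndicator (D : Finset V) (η : SpinConfig V) :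
    Measurable (agreeIndicator D η) := by
  classical
  unfold agreeIndicator
  refine Measurable.ite ?_ measurable_const measurable_const
  have : {σ : SpinConfig V | ∀ x ∈ D, σ x = η x} = ⋂ x ∈ D, (fun σ : SpinConfig V => σ x) ⁻¹' {η x} := by
    ext σ; simp
  rw [this]
  exact Finset.measurableSet_biInter D fun x _ => measurable_pi_apply x (measurableSet_singleton _)

omit [DecidableEq V] [G.LocallyFinite] in
/-- `agreeIndicator` takes the values `0` and `1`. [folklore] -/
theorem agreeIndicator_nonneg (D : Finset V) (η σ : SpinConfig V) : 0 ≤ agreeIndicator D η σ := by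
  unfold agreeIndicator; split_ifs <;> norm_num

omit [DecidableEq V] [G.LocallyFinite] in
/-- `agreeIndicator ≤ 1`. [folklore] -/
theorem agreeIndicator_le_one (D : Finset V) (η σ : SpinConfig V) : agreeIndicator D η σ ≤ 1 := by
  unfold agreeIndicator; split_ifs <;> norm_num

omit [DecidableEq V] [G.LocallyFinite] in
/-- If `η ≡ +1` on `D`, agreement with `η` on `D` is an increasing event. [cite: FriedliVelenik2017, Lemma 3.22] -/
theorem agreeIndicator_mono_of_eq_one {D : Finset V} {η : SpinConfig V} (hη : ∀ x ∈ D, η x = 1) :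
    Monotone (agreeIndicator D η) := by
  intro σ σ' hle
  unfold agreeIndicator
  by_cases h : ∀ x ∈ D, σ x = η x
  · have h' : ∀ x ∈ D, σ' x = η x := fun x hx => by
      have h1 : σ x = 1 := (h x hx).trans (hη x hx)
      have h2 : (1 : ℤˣ) ≤ σ' x := h1 ▸ hle x
      rw [hη x hx]
      exact le_antisymm (intUnits_le_one _) h2
    rw [if_pos h, if_pos h']
  · simp only [h, if_false]
    split_ifs <;> norm_num

omit [DecidableEq V] [G.LocallyFinite] in
/-- If `η ≡ -1` on `D`, agreement with `η` on `D` is a decreasing event. [cite: FriedliVelenik2017, Lemma 3.22] -/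
theorem agreeIndicator_anti_of_eq_neg_one {D : Finset V} {η : SpinConfig V} (hη : ∀ x ∈ D, η x = -1) :
    Antitone (agreeIndicator D η) := by
  intro σ σ' hle
  unfold agreeIndicator
  by_cases h : ∀ x ∈ D, σ' x = η x
  · have h' : ∀ x ∈ D, σ x = η x := fun x hx => by
      have h1 : σ' x = -1 := (h x hx).trans (hη x hx)
      have h2 : σ x ≤ -1 := h1 ▸ hle x
      rw [hη x hx]
      exact le_antisymm h2 (neg_one_le_intUnits _)
    rw [if_pos h, if_pos h']
  · simp only [h, if_false]
    split_ifs <;> norm_num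

/-- **The spatial Markov property, Boltzmann-sum form**: for `Λ' ⊆ Λ` and any `F`,
`∑_τ w^η_Λ(τ) F(τ∨η) 1[τ∨η = η on Λ∖Λ'] = C · ∑_{τ₁} w^η_{Λ'}(τ₁) F(τ₁ ∨ η)` with the positive
constant `C = e^{β(…)}` of the frozen spins `η|_{Λ∖Λ'}` (only the term `τ₂ = η|_{Λ∖Λ'}` of the
two-step sum survives). [cite: FriedliVelenik2017, §3.6.3 eq. (3.26) and Lemma 6.7] -/
theorem sum_fieldWeight_mul_agreeIndicator {Λ' Λ : Finset V} (hsub : Λ' ⊆ Λ) (η : SpinConfig V)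
    (β : ℝ) (h : V → ℝ) (F : SpinConfig V → ℝ) :
    ∑ τ : Λ → ℤˣ, fieldWeight G Λ β h (.fixed η) τ *
        (F (glue Λ τ (.fixed η)) * agreeIndicator (Λ \ Λ') η (glue Λ τ (.fixed η))) =
      Real.exp (β * (∑ e ∈ edgesTouching G Λ \ edgesTouching G Λ', bondSpin η e +
          ∑ x ∈ Λ \ Λ', h x * spinAt x η)) *
        ∑ τ₁ : Λ' → ℤˣ, fieldWeight G Λ' β h (.fixed η) τ₁ * F (glue Λ' τ₁ (.fixed η)) := by
  classical
  refine (sum_fieldWeight_fixed_eq_sum_sum G hsub η β h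
    (fun σ => F σ * agreeIndicator (Λ \ Λ') η σ)).trans ?_
  set τ₀ : ↥(Λ \ Λ') → ℤˣ := fun x => η x with hτ₀
  have hglue₀ : glue (Λ \ Λ') τ₀ (.fixed η) = η := by
    funext x
    by_cases hx : x ∈ Λ \ Λ'
    · rw [glue_apply_of_mem _ _ _ hx]
    · rw [glue_apply_of_notMem _ _ _ hx]; rfl
  rw [Finset.sum_eq_single τ₀]
  · rw [hglue₀]
    congr 1
    refine Finset.sum_congr rfl fun τ₁ _ => ?_
    have : agreeIndicator (Λ \ Λ') η (glue Λ' τ₁ (.fixed η)) = 1 := by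
      unfold agreeIndicator
      rw [if_pos]
      intro x hx
      rw [glue_apply_of_notMem _ _ _ (Finset.mem_sdiff.1 hx).2]
      rfl
    rw [this, mul_one]
  · intro τ₂ _ hne
    have hind : ∀ τ₁ : Λ' → ℤˣ,
        agreeIndicator (Λ \ Λ') η (glue Λ' τ₁ (.fixed (glue (Λ \ Λ') τ₂ (.fixed η)))) = 0 := by
      intro τ₁
      unfold agreeIndicator
      rw [if_neg]
      intro hall
      apply hne
      funext x
      have hx := hall x x.2
      rw [glue_apply_of_notMem _ _ _ (Finset.mem_sdiff.1 x.2).2, BoundaryCondition.outside_fixed,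
        glue_apply_of_mem _ _ _ x.2] at hx
      exact hx
    simp only [hind, mul_zero, Finset.sum_const_zero]
  · intro h; exact absurd (Finset.mem_univ τ₀) h

/-- **The spatial Markov property** (Friedli–Velenik 2017, §3.6.3, eq. (3.26): "`μ^η_{Λ}(· | σ_i = η_i ∀ i ∈ Λ∖Δ) = μ^η_Δ(·)`";
Exercise 3.11), for the Hamiltonian (3.51): for `Λ' ⊆ Λ` and measurable `F`,
`⟨F⟩^η_{Λ';β,h} = ⟨F · 1[σ = η on Λ∖Λ']⟩^η_{Λ;β,h} / ⟨1[σ = η on Λ∖Λ']⟩^η_{Λ;β,h}`.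
[cite: FriedliVelenik2017, §3.6.3 eq. (3.26)] -/
theorem fieldExpect_fixed_eq_cond {Λ' Λ : Finset V} (hsub : Λ' ⊆ Λ) (η : SpinConfig V) (β : ℝ)
    (h : V → ℝ) {F : SpinConfig V → ℝ} (hF : Measurable F) :
    fieldExpect G Λ' β h (.fixed η) F =
      fieldExpect G Λ β h (.fixed η) (fun σ => F σ * agreeIndicator (Λ \ Λ') η σ) /
        fieldExpect G Λ β h (.fixed η) (agreeIndicator (Λ \ Λ') η) := by
  have hI := measurable_agreeIndicator (Λ \ Λ') η
  rw [fieldExpect_eq_sum_div G Λ β h _ (f := fun σ => F σ * agreeIndicator (Λ \ Λ') η σ) (hF.mul hI),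
    fieldExpect_eq_sum_div G Λ β h _ hI, fieldExpect_eq_sum_div G Λ' β h _ hF,
    sum_fieldWeight_mul_agreeIndicator G hsub η β h F]
  have h1 := sum_fieldWeight_mul_agreeIndicator G hsub η β h (fun _ => 1)
  simp only [one_mul, mul_one] at h1
  rw [h1, div_div_div_cancel_right₀ (fieldZ_pos G Λ β h _).ne', mul_div_mul_left _ _ (Real.exp_pos _).ne']
  rfl

/-- The conditioning event has positive probability. [cite: FriedliVelenik2017, §3.6.3 eq. (3.26)] -/
theorem fieldExpect_agreeIndicator_pos {Λ' Λ : Finset V} (hsub : Λ' ⊆ Λ) (η : SpinConfig V) (β : ℝ)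
    (h : V → ℝ) : 0 < fieldExpect G Λ β h (.fixed η) (agreeIndicator (Λ \ Λ') η) := by
  have hI := measurable_agreeIndicator (Λ \ Λ') η
  rw [fieldExpect_eq_sum_div G Λ β h _ hI]
  have h1 := sum_fieldWeight_mul_agreeIndicator G hsub η β h (fun _ => 1)
  simp only [one_mul, mul_one] at h1
  rw [h1]
  exact div_pos (mul_pos (Real.exp_pos _) (fieldZ_pos G Λ' β h _)) (fieldZ_pos G Λ β h _)

/-! ### Monotonicity in the volume -/

/-- **Friedli–Velenik 2017, Lemma 3.22 / eq. (3.25) (expectations with `+` frozen spins decrease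
with the volume), site-dependent field, any boundary condition that is `+1` on the shell**: for
`β ≥ 0`, `Λ' ⊆ Λ`, a boundary condition `η` with `η ≡ +1` on `Λ ∖ Λ'`, and nondecreasing
measurable `F`, `⟨F⟩^η_{Λ;β,h} ≤ ⟨F⟩^η_{Λ';β,h}`: by the spatial Markov property `⟨F⟩^η_{Λ'}` is
`⟨F⟩^η_Λ` conditioned on the increasing event `{σ ≡ +1 on Λ ∖ Λ'}`, and FKG.
[cite: FriedliVelenik2017, Lemma 3.22] -/
theorem fieldExpect_fixed_anti_volume {β : ℝ} (hβ : 0 ≤ β) {Λ' Λ : Finset V} (hsub : Λ' ⊆ Λ)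
    {η : SpinConfig V} (hη : ∀ x ∈ Λ \ Λ', η x = 1) (h : V → ℝ) {F : SpinConfig V → ℝ}
    (hF : Monotone F) (hFm : Measurable F) :
    fieldExpect G Λ β h (.fixed η) F ≤ fieldExpect G Λ' β h (.fixed η) F := by
  have hI := measurable_agreeIndicator (Λ \ Λ') η
  rw [fieldExpect_fixed_eq_cond G hsub η β h hFm,
    le_div_iff₀ (fieldExpect_agreeIndicator_pos G hsub η β h)]
  exact field_fkg G hβ Λ h (.fixed η) F _ hF (agreeIndicator_mono_of_eq_one hη) hFm hI

/-- **Expectations with `-` frozen spins increase with the volume**: for `β ≥ 0`, `Λ' ⊆ Λ`,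
`η ≡ -1` on `Λ ∖ Λ'` and nondecreasing measurable `F`, `⟨F⟩^η_{Λ';β,h} ≤ ⟨F⟩^η_{Λ;β,h}`
(FKG with the decreasing conditioning event). [cite: FriedliVelenik2017, Lemma 3.22] -/
theorem fieldExpect_fixed_mono_volume {β : ℝ} (hβ : 0 ≤ β) {Λ' Λ : Finset V} (hsub : Λ' ⊆ Λ)
    {η : SpinConfig V} (hη : ∀ x ∈ Λ \ Λ', η x = -1) (h : V → ℝ) {F : SpinConfig V → ℝ}
    (hF : Monotone F) (hFm : Measurable F) :
    fieldExpect G Λ' β h (.fixed η) F ≤ fieldExpect G Λ β h (.fixed η) F := by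
  have hI := measurable_agreeIndicator (Λ \ Λ') η
  have hpos := fieldExpect_agreeIndicator_pos G hsub η β h
  rw [fieldExpect_fixed_eq_cond G hsub η β h hFm, div_le_iff₀ hpos]
  -- FKG for `F` and the nondecreasing `1 - 1_E`
  have hanti := agreeIndicator_anti_of_eq_neg_one hη
  have hJm : Measurable fun σ => 1 - agreeIndicator (Λ \ Λ') η σ := measurable_const.sub hI
  have hJmono : Monotone fun σ => 1 - agreeIndicator (Λ \ Λ') η σ :=
    fun σ σ' hle => by linarith [hanti hle]
  have key := field_fkg G hβ Λ h (.fixed η) F _ hF hJmono hFm hJm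
  have e1 : fieldExpect G Λ β h (.fixed η) (F * fun σ => 1 - agreeIndicator (Λ \ Λ') η σ) =
      fieldExpect G Λ β h (.fixed η) F -
        fieldExpect G Λ β h (.fixed η) (fun σ => F σ * agreeIndicator (Λ \ Λ') η σ) := by
    rw [← fieldExpect_sub G Λ β h _ hFm (g := fun σ => F σ * agreeIndicator (Λ \ Λ') η σ)
      (hFm.mul hI)]
    congr 1
    funext σ
    simp only [Pi.mul_apply]
    ring
  have e2 : fieldExpect G Λ β h (.fixed η) (fun σ => 1 - agreeIndicator (Λ \ Λ') η σ) =
      1 - fieldExpect G Λ β h (.fixed η) (agreeIndicator (Λ \ Λ') η) := by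
    rw [fieldExpect_sub G Λ β h _ measurable_const hI, fieldExpect_const_fun]
  rw [e1, e2] at key
  nlinarith [key]

/-! ### The free energy is insensitive to the boundary condition up to surface terms -/

omit [DecidableEq V] [G.LocallyFinite] in
/-- `|σ_e| ≤ 1`. [cite: FriedliVelenik2017, §3.1] -/
theorem abs_bondSpin_le_one' (σ : SpinConfig V) (e : Sym2 V) : |bondSpin σ e| ≤ 1 := by
  induction e using Sym2.ind with
  | _ x y =>
    rw [bondSpin_mk, abs_mul]
    rcases spinAt_eq_one_or_eq_neg_one x σ with hx | hx <;>
      rcases spinAt_eq_one_or_eq_neg_one y σ with hy | hy <;> simp [hx, hy]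

/-- The exponent of the boundary tilt factor is at most `2|∂ᵉΛ|` in absolute value: interior
edges contribute `0`, boundary edges at most `2` each (Friedli–Velenik 2017, proof of
Theorem 3.6: the Hamiltonians with two boundary conditions differ by at most `2β|∂ᵉΛ|`).
[cite: FriedliVelenik2017, §3.2.1, proof of Theorem 3.6] -/
theorem abs_sum_bondSpin_reglue_sub_le (Λ : Finset V) (η₁ η₂ σ : SpinConfig V) :
    |∑ e ∈ edgesTouching G Λ, (bondSpin (reglue Λ η₂ σ) e - bondSpin (reglue Λ η₁ σ) e)| ≤
      2 * (edgeBoundary G Λ).card := by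
  have hin : ∀ e ∈ edgesIn G Λ, bondSpin (reglue Λ η₂ σ) e - bondSpin (reglue Λ η₁ σ) e = 0 := by
    intro e he
    rw [mem_edgesIn_iff] at he
    induction e using Sym2.ind with
    | _ a b =>
      have ha : a ∈ Λ := he.2 a (Sym2.mem_mk_left _ _)
      have hb : b ∈ Λ := he.2 b (Sym2.mem_mk_right _ _)
      simp [bondSpin_mk, spinAt, reglue_apply_of_mem _ _ _ ha, reglue_apply_of_mem _ _ _ hb]
  have hsplit : ∑ e ∈ edgesTouching G Λ, (bondSpin (reglue Λ η₂ σ) e - bondSpin (reglue Λ η₁ σ) e) =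
      ∑ e ∈ edgeBoundary G Λ, (bondSpin (reglue Λ η₂ σ) e - bondSpin (reglue Λ η₁ σ) e) := by
    unfold edgeBoundary
    rw [← Finset.sum_sdiff (edgesIn_subset_edgesTouching (G := G) Λ), Finset.sum_congr rfl hin,
      Finset.sum_const_zero, add_zero]
  rw [hsplit]
  calc |∑ e ∈ edgeBoundary G Λ, (bondSpin (reglue Λ η₂ σ) e - bondSpin (reglue Λ η₁ σ) e)|
      ≤ ∑ e ∈ edgeBoundary G Λ, |bondSpin (reglue Λ η₂ σ) e - bondSpin (reglue Λ η₁ σ) e| :=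
        Finset.abs_sum_le_sum_abs _ _
    _ ≤ ∑ _e ∈ edgeBoundary G Λ, (2 : ℝ) := Finset.sum_le_sum fun e _ => by
        have h1 := abs_bondSpin_le_one' (reglue Λ η₂ σ) e
        have h2 := abs_bondSpin_le_one' (reglue Λ η₁ σ) e
        calc |bondSpin (reglue Λ η₂ σ) e - bondSpin (reglue Λ η₁ σ) e|
            ≤ |bondSpin (reglue Λ η₂ σ) e| + |bondSpin (reglue Λ η₁ σ) e| := abs_sub _ _
          _ ≤ 2 := by linarith
    _ = 2 * (edgeBoundary G Λ).card := by simp [mul_comm]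

/-- Two-sided bounds on the boundary tilt factor: `e^{-2β|∂ᵉΛ|} ≤ R ≤ e^{2β|∂ᵉΛ|}` for `β ≥ 0`.
[cite: FriedliVelenik2017, §3.2.1, proof of Theorem 3.6] -/
theorem bcTiltFactor_mem_Icc {β : ℝ} (hβ : 0 ≤ β) (Λ : Finset V) (η₁ η₂ σ : SpinConfig V) :
    bcTiltFactor G Λ β 0 η₁ η₂ σ ∈ Set.Icc (Real.exp (-(2 * β * (edgeBoundary G Λ).card)))
      (Real.exp (2 * β * (edgeBoundary G Λ).card)) := by
  have hexp : bcTiltFactor G Λ β 0 η₁ η₂ σ = Real.exp (β *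
      ∑ e ∈ edgesTouching G Λ, (bondSpin (reglue Λ η₂ σ) e - bondSpin (reglue Λ η₁ σ) e)) := by
    unfold bcTiltFactor
    congr 1
    rw [neg_mul, ← mul_neg, neg_isingHamiltonian_reglue_sub]
  rw [hexp]
  have hb := abs_sum_bondSpin_reglue_sub_le G Λ η₁ η₂ σ
  rw [abs_le] at hb
  constructor
  · refine Real.exp_le_exp.2 ?_
    nlinarith [hb.1]
  · refine Real.exp_le_exp.2 ?_
    nlinarith [hb.2]

/-- **The partition functions with two boundary conditions are comparable up to surface
factors**: `e^{-2β|∂ᵉΛ|} ≤ Z^{η₂}_{Λ;β,h}/Z^{η₁}_{Λ;β,h} ≤ e^{2β|∂ᵉΛ|}` for `β ≥ 0` and any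
field (Friedli–Velenik 2017, proof of Theorem 3.6 / Lemma 3.8).
[cite: FriedliVelenik2017, §3.2.1, proof of Theorem 3.6] -/
theorem fieldZ_div_fieldZ_mem_Icc {β : ℝ} (hβ : 0 ≤ β) (Λ : Finset V) (h : V → ℝ)
    (η₁ η₂ : SpinConfig V) :
    fieldZ G Λ β h (.fixed η₂) / fieldZ G Λ β h (.fixed η₁) ∈
      Set.Icc (Real.exp (-(2 * β * (edgeBoundary G Λ).card)))
        (Real.exp (2 * β * (edgeBoundary G Λ).card)) := by
  rw [← fieldExpect_bcTiltFactor]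
  have hR := measurable_bcTiltFactor G Λ β 0 η₁ η₂
  constructor
  · have := fieldExpect_mono_fun G Λ β h (.fixed η₁) measurable_const hR
      (fun σ => (bcTiltFactor_mem_Icc G hβ Λ η₁ η₂ σ).1)
    rwa [fieldExpect_const_fun] at this
  · have := fieldExpect_mono_fun G Λ β h (.fixed η₁) hR measurable_const
      (fun σ => (bcTiltFactor_mem_Icc G hβ Λ η₁ η₂ σ).2)
    rwa [fieldExpect_const_fun] at this

/-- **The free energy is insensitive to the boundary condition up to surface terms**
(Friedli–Velenik 2017, proof of Theorem 3.6: `|log Z^{η}_Λ - log Z^{η'}_Λ| ≤ 2β|∂ᵉΛ|`), for a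
site-dependent field and `β ≥ 0`. [cite: FriedliVelenik2017, §3.2.1, proof of Theorem 3.6] -/
theorem abs_log_fieldZ_fixed_sub_le {β : ℝ} (hβ : 0 ≤ β) (Λ : Finset V) (h : V → ℝ)
    (η₁ η₂ : SpinConfig V) :
    |Real.log (fieldZ G Λ β h (.fixed η₂)) - Real.log (fieldZ G Λ β h (.fixed η₁))| ≤
      2 * β * (edgeBoundary G Λ).card := by
  have hZ₁ := fieldZ_pos G Λ β h (.fixed η₁)
  have hZ₂ := fieldZ_pos G Λ β h (.fixed η₂)
  rw [← Real.log_div hZ₂.ne' hZ₁.ne']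
  obtain ⟨hlo, hhi⟩ := fieldZ_div_fieldZ_mem_Icc G hβ Λ h η₁ η₂
  have hq : 0 < fieldZ G Λ β h (.fixed η₂) / fieldZ G Λ β h (.fixed η₁) := div_pos hZ₂ hZ₁
  rw [abs_le]
  constructor
  · have := Real.log_le_log (Real.exp_pos _) hlo
    rwa [Real.log_exp] at this
  · have := Real.log_le_log hq hhi
    rwa [Real.log_exp] at this

end Literature.Probability.LatticeModels

end
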